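import Literature.RepresentationTheory.CompactGroups.LeftInvariantDerivations
import HarnessLib

/-!
# Flows of left-invariant derivations: `α_t = exp (t D_δ)` on the representative functions

Continuation of `LeftInvariantDerivations`. For a linear functional `δ` on `C(G, ℝ)` the
left-invariant derivation `D = leftDeriv δ` preserves every `biSpan u` (`u` translation-finite),
a finite-dimensional space; we exponentiate it there and obtain the **flow**
`flow δ t u = exp (t D) u` on `R = translationFinite G`:

* a small toolkit on `exp (t T)` for a bounded operator `T` on a real Banach space: group law,
  derivative of orbits, **uniqueness for `y' = T y`** (`eq_exp_smul_apply_of_hasDerivAt`, by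
  differentiating `exp (-t T) y(t)`), and the resulting **intertwining lemma**
  `ι ∘ S = T ∘ ι ⇒ ι ∘ exp (t S) = exp (t T) ∘ ι` (`map_exp_smul_of_comm`);
* *flow domains* (finite-dimensional `D`-stable subspaces of `R`: `biSpan u`, intersections,
  sums, and — for a point derivation — products), coordinates `F ≃ ℝⁿ` (all analysis is done in
  the honest normed space `ℝⁿ` and transported), the flow `flowOn`, its independence of the
  domain (`coe_flowOn_eq_coe_flowOn`), and `flow δ t u`;
* properties on `R`: group law in `t`, linearity, `α_t u ∈ biSpan u`, commutation with left
  translations (`flow_lTrans`), **conjugation equivariance** `α^δ_t (κ_g u) = κ_g (α^{δ∘κ_g}_t u)`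
  (`flow_conjTrans`), the derivative `d/dt α_t u = D (α_t u)` and `(α_t u)(x)'(0) = δ(u(x ·))`;
* for a **point derivation**: `α_t 1 = 1` and **multiplicativity** `α_t (uv) = α_t u · α_t v`
  (`IsPointDerivation.flow_mul`: both sides solve `y' = D y` in the flow domain
  `biSpan u * biSpan v`, by the Leibniz rule).

So `α_t` is a one-parameter group of algebra automorphisms of `R` commuting with left translations;
on a compact group it is right translation by a one-parameter subgroup `γ_δ(t)` (next file). This
is the Lie-free exponential map of Hochschild, *The Structure of Lie Groups* (1965), Ch. II §3
("proper automorphisms"), used for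
`Literature.MathematicalPhysics.QuantumLattice.isGroupHeatKernel_unique_up_to_scale`. No named facts.
-/

noncomputable section

open scoped Classical
open NormedSpace Filter Topology

namespace Literature.RepresentationTheory.CompactGroups


section ExpToolkit

variable {E E₂ : Type*} [NormedAddCommGroup E] [NormedSpace ℝ E] [CompleteSpace E]
  [NormedAddCommGroup E₂] [NormedSpace ℝ E₂] [CompleteSpace E₂]

/-- `exp (x + y) = exp x * exp y` for commuting elements of a real Banach algebra (Mathlib states
`NormedSpace.exp_add_of_commute` for `ℚ`-algebras; over `ℝ` we go through the ball version).
[folklore] -/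
theorem exp_add_of_commute_real {𝔸 : Type*} [NormedRing 𝔸] [NormedAlgebra ℝ 𝔸] [CompleteSpace 𝔸]
    {x y : 𝔸} (h : Commute x y) : exp (x + y) = exp x * exp y :=
  exp_add_of_commute_of_mem_ball h
    ((expSeries_radius_eq_top ℝ 𝔸).symm ▸ edist_lt_top _ _)
    ((expSeries_radius_eq_top ℝ 𝔸).symm ▸ edist_lt_top _ _)

/-- The one-parameter group law `exp ((s+t) T) = exp (s T) ∘ exp (t T)`. [folklore] -/
theorem exp_add_smul (T : E →L[ℝ] E) (s t : ℝ) :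
    exp ((s + t) • T) = exp (s • T) * exp (t • T) := by
  rw [add_smul]
  exact exp_add_of_commute_real (((Commute.refl T).smul_left s).smul_right t)

/-- Applied group law: `exp ((s+t) T) x = exp (s T) (exp (t T) x)`. [folklore] -/
theorem exp_add_smul_apply (T : E →L[ℝ] E) (s t : ℝ) (x : E) :
    exp ((s + t) • T) x = exp (s • T) (exp (t • T) x) := by
  rw [exp_add_smul]; rfl

/-- `exp (t T) ∘ exp (t (-T)) = id`. [folklore] -/
theorem exp_smul_mul_exp_smul_neg (T : E →L[ℝ] E) (t : ℝ) :
    exp (t • T) * exp (t • -T) = 1 := by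
  rw [← exp_add_of_commute_real ((((Commute.refl T).neg_right).smul_left t).smul_right t),
    smul_neg, add_neg_cancel, exp_zero]

/-- `exp (t (-T)) ∘ exp (t T) = id`. [folklore] -/
theorem exp_smul_neg_mul_exp_smul (T : E →L[ℝ] E) (t : ℝ) :
    exp (t • -T) * exp (t • T) = 1 := by
  rw [← exp_add_of_commute_real ((((Commute.refl T).neg_left).smul_left t).smul_right t),
    smul_neg, neg_add_cancel, exp_zero]

/-- `exp (t T) (exp (t (-T)) x) = x`. [folklore] -/
theorem exp_smul_apply_exp_smul_neg (T : E →L[ℝ] E) (t : ℝ) (x : E) :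
    exp (t • T) (exp (t • -T) x) = x := by
  have := congrArg (fun A : E →L[ℝ] E => A x) (exp_smul_mul_exp_smul_neg T t)
  simpa using this

/-- `exp (t (-T)) (exp (t T) x) = x`. [folklore] -/
theorem exp_smul_neg_apply_exp_smul (T : E →L[ℝ] E) (t : ℝ) (x : E) :
    exp (t • -T) (exp (t • T) x) = x := by
  have := congrArg (fun A : E →L[ℝ] E => A x) (exp_smul_neg_mul_exp_smul T t)
  simpa using this

omit [CompleteSpace E] in
/-- An operator commuting with `A` commutes with `exp A` (applied form). [folklore] -/
theorem apply_exp_comm_of_commute {T A : E →L[ℝ] E} (h : Commute T A) (x : E) :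
    T (exp A x) = exp A (T x) :=
  congrArg (fun B : E →L[ℝ] E => B x) h.exp_right.eq

omit [CompleteSpace E] in
/-- `T` commutes with `exp (t T)` (applied form). [folklore] -/
theorem apply_exp_smul_comm (T : E →L[ℝ] E) (t : ℝ) (x : E) :
    T (exp (t • T) x) = exp (t • T) (T x) :=
  apply_exp_comm_of_commute ((Commute.refl T).smul_right t) x

/-- Derivative of the orbit `s ↦ exp (s T) x`: `T (exp (t T) x)`. [folklore] -/
theorem hasDerivAt_exp_smul_apply (T : E →L[ℝ] E) (x : E) (t : ℝ) :
    HasDerivAt (fun s : ℝ => exp (s • T) x) (T (exp (t • T) x)) t := by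
  have h := (hasDerivAt_exp_smul_const' (𝕂 := ℝ) T t).clm_apply (hasDerivAt_const t x)
  simpa using h

/-- The orbit `s ↦ exp (s T) x` is continuous. [folklore] -/
theorem continuous_exp_smul_apply (T : E →L[ℝ] E) (x : E) :
    Continuous fun s : ℝ => exp (s • T) x :=
  continuous_iff_continuousAt.mpr fun t => (hasDerivAt_exp_smul_apply T x t).continuousAt

/-- **Uniqueness for the linear ODE `y' = T y`**: a solution with `y 0 = x` is `y t = exp (t T) x`
(conjugate by `exp (t (-T))` and differentiate). [folklore] -/
theorem eq_exp_smul_apply_of_hasDerivAt (T : E →L[ℝ] E) {y : ℝ → E} {x : E}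
    (hy : ∀ t, HasDerivAt y (T (y t)) t) (h0 : y 0 = x) (t : ℝ) : y t = exp (t • T) x := by
  set Φ : ℝ → E := fun s => exp (s • -T) (y s) with hΦ
  have hΦ' : ∀ s, HasDerivAt Φ 0 s := by
    intro s
    have h1 := hasDerivAt_exp_smul_const' (𝕂 := ℝ) (-T) s
    have h2 := h1.clm_apply (hy s)
    have hc : T (exp (s • -T) (y s)) = exp (s • -T) (T (y s)) :=
      apply_exp_comm_of_commute (((Commute.refl T).neg_right).smul_right s) _
    have hzero : (-T * exp (s • -T)) (y s) + exp (s • -T) (T (y s)) = 0 := by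
      change (-T) (exp (s • -T) (y s)) + exp (s • -T) (T (y s)) = 0
      change -(T (exp (s • -T) (y s))) + exp (s • -T) (T (y s)) = 0
      rw [hc, neg_add_cancel]
    rw [hzero] at h2
    exact h2
  have hconst : ∀ a b, Φ a = Φ b :=
    is_const_of_deriv_eq_zero (fun s => (hΦ' s).differentiableAt) fun s => (hΦ' s).deriv
  have key : Φ t = x := by
    rw [hconst t 0]
    simp [hΦ, h0]
  have h3 := congrArg (fun z => exp (t • T) z) key
  simp only [hΦ, exp_smul_apply_exp_smul_neg] at h3
  exact h3

/-- **Intertwiners commute with the exponential**: if `ι ∘ S = T ∘ ι` for a continuous linear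
`ι : E → E₂`, then `ι (exp (t S) x) = exp (t T) (ι x)`. [folklore] -/
theorem map_exp_smul_of_comm (ι : E →L[ℝ] E₂) (S : E →L[ℝ] E) (T : E₂ →L[ℝ] E₂)
    (h : ∀ x, ι (S x) = T (ι x)) (t : ℝ) (x : E) : ι (exp (t • S) x) = exp (t • T) (ι x) := by
  refine eq_exp_smul_apply_of_hasDerivAt T (y := fun s => ι (exp (s • S) x)) (fun s => ?_)
    (by simp) t
  have := (ι.hasFDerivAt).comp_hasDerivAt s (hasDerivAt_exp_smul_apply S x s)
  simpa [Function.comp_def, h] using this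

/-- If `T x = 0` then `exp (t T) x = x`. [folklore] -/
theorem exp_smul_apply_eq_self_of_apply_eq_zero (T : E →L[ℝ] E) {x : E} (hx : T x = 0) (t : ℝ) :
    exp (t • T) x = x := by
  have := eq_exp_smul_apply_of_hasDerivAt T (y := fun _ => x) (x := x)
    (fun s => by simpa [hx] using hasDerivAt_const s x) rfl t
  exact this.symm

omit [CompleteSpace E] in
/-- Commuting generators give commuting exponentials (applied form). [folklore] -/
theorem exp_smul_apply_comm_of_commute {S T : E →L[ℝ] E} (h : Commute S T) (s t : ℝ) (x : E) :
    exp (s • S) (exp (t • T) x) = exp (t • T) (exp (s • S) x) := by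
  have hc : Commute (exp (s • S)) (exp (t • T)) :=
    ((h.smul_left s).smul_right t).exp_right.exp_left
  exact congrArg (fun A : E →L[ℝ] E => A x) hc.eq

end ExpToolkit


/-! ### Flow domains and the exponential of a left-invariant derivation -/

section Flows

variable {G : Type*} [TopologicalSpace G] [Group G] [IsTopologicalGroup G]

/-- A **flow domain** for the functional `δ`: a finite-dimensional subspace of the representative
functions stable under the left-invariant derivation `leftDeriv δ` (e.g. `biSpan u`). [folklore] -/
structure IsFlowDomain (δ : C(G, ℝ) →ₗ[ℝ] ℝ) (F : Submodule ℝ C(G, ℝ)) : Prop where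
  le : F ≤ Subalgebra.toSubmodule (translationFinite G)
  fd : FiniteDimensional ℝ F
  inv : ∀ v ∈ F, leftDeriv δ v ∈ F

variable (δ : C(G, ℝ) →ₗ[ℝ] ℝ)

/-- `biSpan u` is a flow domain for every functional (`u` translation-finite). [folklore] -/
theorem isFlowDomain_biSpan {u : C(G, ℝ)} (hu : u ∈ translationFinite G) :
    IsFlowDomain δ (biSpan u) :=
  ⟨biSpan_le_translationFinite hu, IsTranslationFinite.finiteDimensional hu,
    fun _ hv => leftDeriv_mem_biSpan_of_mem δ hu hv⟩

/-- Intersections of flow domains are flow domains. [folklore] -/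
theorem IsFlowDomain.inf {F F' : Submodule ℝ C(G, ℝ)} (hF : IsFlowDomain δ F)
    (hF' : IsFlowDomain δ F') : IsFlowDomain δ (F ⊓ F') :=
  ⟨inf_le_left.trans hF.le, by haveI := hF.fd; exact Submodule.finiteDimensional_inf_left _ _,
    fun v hv => ⟨hF.inv v hv.1, hF'.inv v hv.2⟩⟩

/-- Sums of flow domains are flow domains. [folklore] -/
theorem IsFlowDomain.sup {F F' : Submodule ℝ C(G, ℝ)} (hF : IsFlowDomain δ F)
    (hF' : IsFlowDomain δ F') : IsFlowDomain δ (F ⊔ F') := by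
  haveI := hF.fd; haveI := hF'.fd
  refine ⟨sup_le hF.le hF'.le, Submodule.finiteDimensional_sup _ _, fun v hv => ?_⟩
  obtain ⟨a, ha, b, hb, rfl⟩ := Submodule.mem_sup.mp hv
  rw [leftDeriv_add δ (hF.le ha) (hF'.le hb)]
  exact Submodule.add_mem_sup (hF.inv a ha) (hF'.inv b hb)

/-- Products of flow domains are flow domains for a point derivation (Leibniz rule). [folklore] -/
theorem IsFlowDomain.mul {δ : C(G, ℝ) →ₗ[ℝ] ℝ} (hδ : IsPointDerivation δ)
    {F F' : Submodule ℝ C(G, ℝ)} (hF : IsFlowDomain δ F) (hF' : IsFlowDomain δ F') :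
    IsFlowDomain δ (F * F') := by
  haveI := hF.fd; haveI := hF'.fd
  have hle : F * F' ≤ Subalgebra.toSubmodule (translationFinite G) := by
    rw [Submodule.mul_le]
    intro a ha b hb
    exact (translationFinite G).mul_mem (hF.le ha) (hF'.le hb)
  refine ⟨hle, ?_, fun v hv => ?_⟩
  · exact (Submodule.fg_iff_finiteDimensional _).mp
      ((Submodule.fg_iff_finiteDimensional _ |>.mpr inferInstance).mul
        (Submodule.fg_iff_finiteDimensional _ |>.mpr inferInstance))
  · suffices h : v ∈ F * F' ∧ leftDeriv δ v ∈ F * F' from h.2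
    refine Submodule.mul_induction_on hv (fun a ha b hb => ⟨Submodule.mul_mem_mul ha hb, ?_⟩)
      (fun x y hx hy => ⟨Submodule.add_mem _ hx.1 hy.1, ?_⟩)
    · rw [hδ.leftDeriv_mul (hF.le ha) (hF'.le hb)]
      exact Submodule.add_mem _ (Submodule.mul_mem_mul (hF.inv a ha) hb)
        (Submodule.mul_mem_mul ha (hF'.inv b hb))
    · rw [leftDeriv_add δ (hle hx.1) (hle hy.1)]
      exact Submodule.add_mem _ hx.2 hy.2

/-! #### Coordinates on a flow domain and the flow

All analysis (exponentials, derivatives) is done in the coordinate space `Fin n → ℝ` of a flow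
domain, `n = finrank F`, which is a genuine finite-dimensional normed space; the flow on `F` is
obtained by transport along the coordinate isomorphism. -/

/-- The coordinate space `ℝⁿ`, `n = finrank F`, of a flow domain. [folklore] -/
abbrev Vec (F : Submodule ℝ C(G, ℝ)) : Type := Fin (Module.finrank ℝ F) → ℝ

/-- Linear coordinates `F ≃ ℝⁿ` on a flow domain (a chosen basis). [folklore] -/
def coord {F : Submodule ℝ C(G, ℝ)} (hF : IsFlowDomain δ F) : F ≃ₗ[ℝ] Vec F :=
  haveI := hF.fd
  (Module.finBasis ℝ F).equivFun

/-- The left-invariant derivation restricted to a flow domain, as a linear map `F → F`. [folklore] -/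
def derivLin {F : Submodule ℝ C(G, ℝ)} (hF : IsFlowDomain δ F) : F →ₗ[ℝ] F where
  toFun v := ⟨leftDeriv δ v, hF.inv v v.2⟩
  map_add' v w := Subtype.ext (leftDeriv_add δ (hF.le v.2) (hF.le w.2))
  map_smul' c v := Subtype.ext (leftDeriv_smul δ c (hF.le v.2))

/-- `derivLin` is `leftDeriv` underneath. [folklore] -/
@[simp]
theorem coe_derivLin {F : Submodule ℝ C(G, ℝ)} (hF : IsFlowDomain δ F) (v : F) :
    (derivLin δ hF v : C(G, ℝ)) = leftDeriv δ v := rfl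

/-- The derivation in coordinates, a bounded operator on `ℝⁿ`. [folklore] -/
def derivVec {F : Submodule ℝ C(G, ℝ)} (hF : IsFlowDomain δ F) : Vec F →L[ℝ] Vec F :=
  LinearMap.toContinuousLinearMap
    ((coord δ hF).toLinearMap ∘ₗ derivLin δ hF ∘ₗ (coord δ hF).symm.toLinearMap)

/-- `derivVec` in terms of `derivLin`. [folklore] -/
@[simp]
theorem derivVec_apply {F : Submodule ℝ C(G, ℝ)} (hF : IsFlowDomain δ F) (c : Vec F) :
    derivVec δ hF c = coord δ hF (derivLin δ hF ((coord δ hF).symm c)) := rfl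

/-- The flow `exp (t D_F)` on a flow domain, transported from coordinates. [folklore] -/
def flowOn {F : Submodule ℝ C(G, ℝ)} (hF : IsFlowDomain δ F) (t : ℝ) : F →ₗ[ℝ] F :=
  (coord δ hF).symm.toLinearMap ∘ₗ
    ((NormedSpace.exp (t • derivVec δ hF) : Vec F →L[ℝ] Vec F) : Vec F →ₗ[ℝ] Vec F) ∘ₗ
      (coord δ hF).toLinearMap

/-- `flowOn` in coordinates: `coord (flowOn t v) = exp (t D̃) (coord v)`. [folklore] -/
@[simp]
theorem coord_flowOn {F : Submodule ℝ C(G, ℝ)} (hF : IsFlowDomain δ F) (t : ℝ) (v : F) :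
    coord δ hF (flowOn δ hF t v) = NormedSpace.exp (t • derivVec δ hF) (coord δ hF v) := by
  simp [flowOn]

/-- `flowOn t v = coord⁻¹ (exp (t D̃) (coord v))`. [folklore] -/
theorem flowOn_apply {F : Submodule ℝ C(G, ℝ)} (hF : IsFlowDomain δ F) (t : ℝ) (v : F) :
    flowOn δ hF t v = (coord δ hF).symm (NormedSpace.exp (t • derivVec δ hF) (coord δ hF v)) := rfl

/-- **Compatibility of flows on nested domains**: for flow domains `F ≤ F'` the flows agree on `F`
(the inclusion, read in coordinates, intertwines the two coordinate derivations). [folklore] -/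
theorem coe_flowOn_eq_of_le {F F' : Submodule ℝ C(G, ℝ)} (hF : IsFlowDomain δ F)
    (hF' : IsFlowDomain δ F') (hle : F ≤ F') (t : ℝ) (v : F) :
    (flowOn δ hF t v : C(G, ℝ)) = flowOn δ hF' t ⟨v, hle v.2⟩ := by
  let ι : Vec F →L[ℝ] Vec F' := LinearMap.toContinuousLinearMap
    ((coord δ hF').toLinearMap ∘ₗ Submodule.inclusion hle ∘ₗ (coord δ hF).symm.toLinearMap)
  have hι : ∀ c : Vec F, ι (derivVec δ hF c) = derivVec δ hF' (ι c) := by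
    intro c
    simp only [ι, LinearMap.coe_toContinuousLinearMap', LinearMap.coe_comp, LinearEquiv.coe_coe,
      Function.comp_apply, derivVec_apply, LinearEquiv.symm_apply_apply]
    congr 1
  have key := map_exp_smul_of_comm ι (derivVec δ hF) (derivVec δ hF') hι t (coord δ hF v)
  simp only [ι, LinearMap.coe_toContinuousLinearMap', LinearMap.coe_comp, LinearEquiv.coe_coe,
    Function.comp_apply, LinearEquiv.symm_apply_apply] at key
  -- `key : coord' (incl (coord⁻¹ (exp (coord v)))) = exp' (coord' (incl v))`
  have key' := congrArg (fun c => (((coord δ hF').symm c : F') : C(G, ℝ))) key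
  simp only [LinearEquiv.symm_apply_apply, Submodule.coe_inclusion] at key'
  rw [flowOn_apply, flowOn_apply]
  exact key'

/-- Flows on two flow domains agree on their common elements. [folklore] -/
theorem coe_flowOn_eq_coe_flowOn {F F' : Submodule ℝ C(G, ℝ)} (hF : IsFlowDomain δ F)
    (hF' : IsFlowDomain δ F') {u : C(G, ℝ)} (hu : u ∈ F) (hu' : u ∈ F') (t : ℝ) :
    (flowOn δ hF t ⟨u, hu⟩ : C(G, ℝ)) = flowOn δ hF' t ⟨u, hu'⟩ := by
  have h1 := coe_flowOn_eq_of_le δ (hF.inf δ hF') hF inf_le_left t ⟨u, ⟨hu, hu'⟩⟩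
  have h2 := coe_flowOn_eq_of_le δ (hF.inf δ hF') hF' inf_le_right t ⟨u, ⟨hu, hu'⟩⟩
  exact h1.symm.trans h2

/-- **The flow `α_t = exp (t leftDeriv δ)` on the representative functions**: `flow δ t u` is the
value at `u` of `exp (t D)` computed in the flow domain `biSpan u` (junk `0` off `R`). For a point
derivation `δ` of a compact group this is `u ↦ u(· γ_δ(t))` for the one-parameter subgroup `γ_δ`
generated by `δ` (next file). [folklore] -/
def flow (t : ℝ) (u : C(G, ℝ)) : C(G, ℝ) :=
  if hu : u ∈ translationFinite G then
    (flowOn δ (isFlowDomain_biSpan δ hu) t ⟨u, self_mem_biSpan u⟩ : C(G, ℝ))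
  else 0

/-- `flow δ t u` may be computed in any flow domain containing `u`. [folklore] -/
theorem flow_eq_coe_flowOn {F : Submodule ℝ C(G, ℝ)} (hF : IsFlowDomain δ F) {u : C(G, ℝ)}
    (hu : u ∈ F) (t : ℝ) : flow δ t u = (flowOn δ hF t ⟨u, hu⟩ : C(G, ℝ)) := by
  have huR : u ∈ translationFinite G := hF.le hu
  rw [flow, dif_pos huR]
  exact coe_flowOn_eq_coe_flowOn δ _ hF _ hu t

/-- `flow δ t u ∈ biSpan u`. [folklore] -/
theorem flow_mem_biSpan {u : C(G, ℝ)} (hu : u ∈ translationFinite G) (t : ℝ) :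
    flow δ t u ∈ biSpan u := by
  rw [flow, dif_pos hu]; exact Subtype.mem _

/-- The flow preserves flow domains. [folklore] -/
theorem flow_mem_of_mem {F : Submodule ℝ C(G, ℝ)} (hF : IsFlowDomain δ F) {u : C(G, ℝ)}
    (hu : u ∈ F) (t : ℝ) : flow δ t u ∈ F := by
  rw [flow_eq_coe_flowOn δ hF hu]; exact Subtype.mem _

/-- `flow δ t u` is translation-finite. [folklore] -/
theorem flow_mem {u : C(G, ℝ)} (hu : u ∈ translationFinite G) (t : ℝ) :
    flow δ t u ∈ translationFinite G :=
  biSpan_le_translationFinite hu (flow_mem_biSpan δ hu t)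

/-- Off `R` the flow is the junk value `0`. [folklore] -/
theorem flow_of_not_mem {u : C(G, ℝ)} (hu : u ∉ translationFinite G) (t : ℝ) : flow δ t u = 0 := by
  rw [flow, dif_neg hu]

/-- `α_0 = id` on `R`. [folklore] -/
theorem flow_zero {u : C(G, ℝ)} (hu : u ∈ translationFinite G) : flow δ 0 u = u := by
  rw [flow, dif_pos hu, flowOn_apply, zero_smul, NormedSpace.exp_zero]
  simp

/-- **Group law** `α_{s+t} = α_s ∘ α_t`. [folklore] -/
theorem flow_add_time {u : C(G, ℝ)} (hu : u ∈ translationFinite G) (s t : ℝ) :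
    flow δ (s + t) u = flow δ s (flow δ t u) := by
  have hF := isFlowDomain_biSpan δ hu
  rw [flow_eq_coe_flowOn δ hF (self_mem_biSpan u), flow_eq_coe_flowOn δ hF (flow_mem_biSpan δ hu t),
    flowOn_apply, flowOn_apply, exp_add_smul_apply]
  congr 3
  have : (⟨flow δ t u, flow_mem_biSpan δ hu t⟩ : biSpan u) = flowOn δ hF t ⟨u, self_mem_biSpan u⟩ :=
    Subtype.ext (flow_eq_coe_flowOn δ hF (self_mem_biSpan u) t)
  rw [this, coord_flowOn]

/-- Additivity of `α_t` on `R`. [folklore] -/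
theorem flow_add {u v : C(G, ℝ)} (hu : u ∈ translationFinite G) (hv : v ∈ translationFinite G)
    (t : ℝ) : flow δ t (u + v) = flow δ t u + flow δ t v := by
  have hF := (isFlowDomain_biSpan δ hu).sup δ (isFlowDomain_biSpan δ hv)
  have huF : u ∈ biSpan u ⊔ biSpan v := Submodule.mem_sup_left (self_mem_biSpan u)
  have hvF : v ∈ biSpan u ⊔ biSpan v := Submodule.mem_sup_right (self_mem_biSpan v)
  rw [flow_eq_coe_flowOn δ hF (Submodule.add_mem _ huF hvF), flow_eq_coe_flowOn δ hF huF,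
    flow_eq_coe_flowOn δ hF hvF, ← Submodule.coe_add, ← map_add]
  rfl

/-- Homogeneity of `α_t` on `R`. [folklore] -/
theorem flow_smul (c : ℝ) {u : C(G, ℝ)} (hu : u ∈ translationFinite G) (t : ℝ) :
    flow δ t (c • u) = c • flow δ t u := by
  have hF := isFlowDomain_biSpan δ hu
  have hcu : c • u ∈ biSpan u := Submodule.smul_mem _ c (self_mem_biSpan u)
  rw [flow_eq_coe_flowOn δ hF hcu, flow_eq_coe_flowOn δ hF (self_mem_biSpan u),
    ← Submodule.coe_smul, ← map_smul]
  rfl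

/-- `α_t 0 = 0`. [folklore] -/
theorem flow_zero_fun (t : ℝ) : flow δ t (0 : C(G, ℝ)) = 0 := by
  have := flow_smul δ 0 (translationFinite G).zero_mem t
  simpa using this

/-- If `leftDeriv δ u = 0` then `α_t u = u`. [folklore] -/
theorem flow_eq_self_of_leftDeriv_eq_zero {u : C(G, ℝ)} (hu : u ∈ translationFinite G)
    (h0 : leftDeriv δ u = 0) (t : ℝ) : flow δ t u = u := by
  have hF := isFlowDomain_biSpan δ hu
  have hD : derivVec δ hF (coord δ hF ⟨u, self_mem_biSpan u⟩) = 0 := by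
    rw [derivVec_apply, LinearEquiv.symm_apply_apply]
    have : derivLin δ hF ⟨u, self_mem_biSpan u⟩ = 0 := Subtype.ext h0
    rw [this, map_zero]
  rw [flow_eq_coe_flowOn δ hF (self_mem_biSpan u), flowOn_apply,
    exp_smul_apply_eq_self_of_apply_eq_zero _ hD, LinearEquiv.symm_apply_apply]

/-- A point derivation's flow fixes the constants: `α_t 1 = 1`. [folklore] -/
theorem IsPointDerivation.flow_one {δ : C(G, ℝ) →ₗ[ℝ] ℝ} (hδ : IsPointDerivation δ) (t : ℝ) :
    flow δ t (1 : C(G, ℝ)) = 1 :=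
  flow_eq_self_of_leftDeriv_eq_zero δ (translationFinite G).one_mem hδ.leftDeriv_one t

/-- Transport of an endomorphism `A` of `biSpan u`-type domains: if a linear map `A : F → F` of a
flow domain intertwines two coordinate derivations, the corresponding flows are intertwined.
Technical form used for left translations and conjugations. [folklore] -/
theorem coe_flowOn_map {F : Submodule ℝ C(G, ℝ)} {δ' : C(G, ℝ) →ₗ[ℝ] ℝ}
    (hF : IsFlowDomain δ F) (hF' : IsFlowDomain δ' F) (A : F →ₗ[ℝ] F)
    (hA : ∀ w : F, (A (derivLin δ' hF' w) : C(G, ℝ)) = leftDeriv δ (A w)) (t : ℝ) (v : F) :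
    (A (flowOn δ' hF' t v) : C(G, ℝ)) = flowOn δ hF t (A v) := by
  let ι : Vec F →L[ℝ] Vec F := LinearMap.toContinuousLinearMap
    ((coord δ hF).toLinearMap ∘ₗ A ∘ₗ (coord δ' hF').symm.toLinearMap)
  have hι : ∀ c : Vec F, ι (derivVec δ' hF' c) = derivVec δ hF (ι c) := by
    intro c
    simp only [ι, LinearMap.coe_toContinuousLinearMap', LinearMap.coe_comp, LinearEquiv.coe_coe,
      Function.comp_apply, derivVec_apply, LinearEquiv.symm_apply_apply]
    congr 1
    exact Subtype.ext (hA _)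
  have key := map_exp_smul_of_comm ι (derivVec δ' hF') (derivVec δ hF) hι t (coord δ' hF' v)
  simp only [ι, LinearMap.coe_toContinuousLinearMap', LinearMap.coe_comp, LinearEquiv.coe_coe,
    Function.comp_apply, LinearEquiv.symm_apply_apply] at key
  have key' := congrArg (fun c => (((coord δ hF).symm c : F) : C(G, ℝ))) key
  simp only [LinearEquiv.symm_apply_apply] at key'
  rw [flowOn_apply, flowOn_apply]
  exact key'

/-- **`α_t` commutes with left translations** (`leftDeriv δ` is left invariant). [folklore] -/
theorem flow_lTrans (g : G) {u : C(G, ℝ)} (hu : u ∈ translationFinite G) (t : ℝ) :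
    flow δ t (lTrans g u) = lTrans g (flow δ t u) := by
  have hF := isFlowDomain_biSpan δ hu
  let A : biSpan u →ₗ[ℝ] biSpan u := (lTrans g).toLinearMap.restrict fun v hv => lTrans_mem_biSpan g hv
  have hA : ∀ w : biSpan u, (A (derivLin δ hF w) : C(G, ℝ)) = leftDeriv δ (A w) := fun w => by
    change lTrans g (leftDeriv δ w) = leftDeriv δ (lTrans g w)
    rw [leftDeriv_lTrans δ g (hF.le w.2)]
  have key := coe_flowOn_map δ hF hF A hA t ⟨u, self_mem_biSpan u⟩
  have hgu : lTrans g u ∈ biSpan u := lTrans_mem_biSpan g (self_mem_biSpan u)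
  rw [flow_eq_coe_flowOn δ hF hgu, flow_eq_coe_flowOn δ hF (self_mem_biSpan u)]
  exact key.symm

/-- The conjugation action `κ_g u = u(g · g⁻¹)` on `C(G, ℝ)` as an algebra endomorphism. [folklore] -/
def conjTrans (g : G) : C(G, ℝ) →ₐ[ℝ] C(G, ℝ) := (lTrans g).comp (rTrans g⁻¹)

/-- Unfolding `conjTrans`. [folklore] -/
@[simp] theorem conjTrans_apply (g : G) (u : C(G, ℝ)) (x : G) : conjTrans g u x = u (g * x * g⁻¹) := by
  simp [conjTrans, mul_assoc]

/-- `κ_g u = lTrans g (rTrans g⁻¹ u)`. [folklore] -/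
theorem conjTrans_eq (g : G) (u : C(G, ℝ)) : conjTrans g u = lTrans g (rTrans g⁻¹ u) := rfl

/-- `κ_g` preserves `biSpan u`. [folklore] -/
theorem conjTrans_mem_biSpan (g : G) {u v : C(G, ℝ)} (hv : v ∈ biSpan u) : conjTrans g v ∈ biSpan u :=
  lTrans_mem_biSpan g (rTrans_mem_biSpan g⁻¹ hv)

/-- `κ_g` preserves `R`. [folklore] -/
theorem conjTrans_mem_translationFinite (g : G) {u : C(G, ℝ)} (hu : u ∈ translationFinite G) :
    conjTrans g u ∈ translationFinite G :=
  lTrans_mem_translationFinite (rTrans_mem_translationFinite hu _) _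

/-- `κ_1 = id`. [folklore] -/
@[simp] theorem conjTrans_one (u : C(G, ℝ)) : conjTrans (1 : G) u = u := by ext x; simp

/-- `κ_{gh} = κ_h ∘ κ_g` (a right action on functions). [folklore] -/
theorem conjTrans_mul (g h : G) (u : C(G, ℝ)) : conjTrans (g * h) u = conjTrans h (conjTrans g u) := by
  ext x; simp [mul_assoc]

/-- **`κ_g` intertwines `leftDeriv (δ ∘ κ_g)` with `leftDeriv δ`**:
`κ_g (leftDeriv (δ ∘ κ_g) u) = leftDeriv δ (κ_g u)`. [folklore] -/
theorem conjTrans_leftDeriv_comp (g : G) {u : C(G, ℝ)} (hu : u ∈ translationFinite G) :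
    conjTrans g (leftDeriv (δ.comp (conjTrans g).toLinearMap) u) = leftDeriv δ (conjTrans g u) := by
  ext x
  rw [conjTrans_apply, leftDeriv_apply _ hu, leftDeriv_apply δ (conjTrans_mem_translationFinite g hu),
    LinearMap.comp_apply, AlgHom.toLinearMap_apply]
  congr 1
  ext y
  simp [mul_assoc]

/-- **Conjugation equivariance of the flows**: `α^δ_t (κ_g u) = κ_g (α^{δ ∘ κ_g}_t u)`. This is the
algebraic form of `g γ_δ(t) g⁻¹ = γ_{δ ∘ κ_g}(t)`. [folklore] -/
theorem flow_conjTrans (g : G) {u : C(G, ℝ)} (hu : u ∈ translationFinite G) (t : ℝ) :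
    flow δ t (conjTrans g u) = conjTrans g (flow (δ.comp (conjTrans g).toLinearMap) t u) := by
  set δ' := δ.comp (conjTrans g).toLinearMap with hδ'
  have hF := isFlowDomain_biSpan δ hu
  have hF' := isFlowDomain_biSpan δ' hu
  let A : biSpan u →ₗ[ℝ] biSpan u :=
    (conjTrans g).toLinearMap.restrict fun v hv => conjTrans_mem_biSpan g hv
  have hA : ∀ w : biSpan u, (A (derivLin δ' hF' w) : C(G, ℝ)) = leftDeriv δ (A w) := fun w => by
    change conjTrans g (leftDeriv δ' w) = leftDeriv δ (conjTrans g w)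
    exact conjTrans_leftDeriv_comp δ g (hF.le w.2)
  have key := coe_flowOn_map δ hF hF' A hA t ⟨u, self_mem_biSpan u⟩
  have hgu : conjTrans g u ∈ biSpan u := conjTrans_mem_biSpan g (self_mem_biSpan u)
  rw [flow_eq_coe_flowOn δ hF hgu, flow_eq_coe_flowOn δ' hF' (self_mem_biSpan u)]
  exact key.symm

end Flows

/-! ### Derivatives and multiplicativity (compact group: `C(G, ℝ)` is a Banach algebra) -/

section Compact

variable {G : Type*} [TopologicalSpace G] [Group G] [IsTopologicalGroup G] [CompactSpace G]
variable (δ : C(G, ℝ) →ₗ[ℝ] ℝ)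

/-- The map `ℝⁿ → C(G, ℝ)`, `c ↦ coord⁻¹ c`, as a bounded operator. [folklore] -/
def coordOut {F : Submodule ℝ C(G, ℝ)} (hF : IsFlowDomain δ F) : Vec F →L[ℝ] C(G, ℝ) :=
  LinearMap.toContinuousLinearMap (F.subtype ∘ₗ (coord δ hF).symm.toLinearMap)

omit [CompactSpace G] in
/-- `coordOut c = ↑(coord⁻¹ c)`. [folklore] -/
@[simp]
theorem coordOut_apply {F : Submodule ℝ C(G, ℝ)} (hF : IsFlowDomain δ F) (c : Vec F) :
    coordOut δ hF c = ((coord δ hF).symm c : C(G, ℝ)) := rfl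

/-- **Derivative of the flow**: `d/ds α_s u = leftDeriv δ (α_s u)` (as a `C(G, ℝ)`-valued curve). [folklore] -/
theorem hasDerivAt_flow {u : C(G, ℝ)} (hu : u ∈ translationFinite G) (t : ℝ) :
    HasDerivAt (fun s => flow δ s u) (leftDeriv δ (flow δ t u)) t := by
  have hF := isFlowDomain_biSpan δ hu
  set c₀ := coord δ hF ⟨u, self_mem_biSpan u⟩
  have h := (coordOut δ hF).hasFDerivAt.comp_hasDerivAt t (hasDerivAt_exp_smul_apply (derivVec δ hF) c₀ t)
  have hfun : (coordOut δ hF ∘ fun s => NormedSpace.exp (s • derivVec δ hF) c₀) = fun s => flow δ s u := by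
    funext s
    rw [Function.comp_apply, coordOut_apply, flow_eq_coe_flowOn δ hF (self_mem_biSpan u), flowOn_apply]
  rw [hfun] at h
  have hval : coordOut δ hF (derivVec δ hF (NormedSpace.exp (t • derivVec δ hF) c₀)) =
      leftDeriv δ (flow δ t u) := by
    rw [coordOut_apply, derivVec_apply, LinearEquiv.symm_apply_apply, coe_derivLin,
      flow_eq_coe_flowOn δ hF (self_mem_biSpan u), flowOn_apply]
  rw [hval] at h
  exact h

/-- The flow is continuous in time (as a `C(G, ℝ)`-valued curve). [folklore] -/
theorem continuous_flow {u : C(G, ℝ)} (hu : u ∈ translationFinite G) :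
    Continuous fun s => flow δ s u :=
  continuous_iff_continuousAt.mpr fun t => (hasDerivAt_flow δ hu t).continuousAt

/-- Derivative of `s ↦ (α_s u)(x)`: `(leftDeriv δ (α_t u))(x)`. [folklore] -/
theorem hasDerivAt_flow_apply {u : C(G, ℝ)} (hu : u ∈ translationFinite G) (x : G) (t : ℝ) :
    HasDerivAt (fun s => flow δ s u x) (leftDeriv δ (flow δ t u) x) t := by
  have h := ((ContinuousMap.evalCLM ℝ x).hasFDerivAt).comp_hasDerivAt t (hasDerivAt_flow δ hu t)
  simpa [Function.comp_def] using h

/-- Derivative at `0`: `d/ds (α_s u)(x) |_{s=0} = δ(u(x ·))`. [folklore] -/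
theorem hasDerivAt_flow_apply_zero {u : C(G, ℝ)} (hu : u ∈ translationFinite G) (x : G) :
    HasDerivAt (fun s => flow δ s u x) (δ (lTrans x u)) 0 := by
  have := hasDerivAt_flow_apply δ hu x 0
  rwa [flow_zero δ hu, leftDeriv_apply δ hu] at this

/-- Continuity of `s ↦ (α_s u)(x)`. [folklore] -/
theorem continuous_flow_apply {u : C(G, ℝ)} (hu : u ∈ translationFinite G) (x : G) :
    Continuous fun s => flow δ s u x :=
  (ContinuousMap.evalCLM ℝ x).continuous.comp (continuous_flow δ hu)

/-- The multiplication of two flow domains in coordinates, a continuous bilinear map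
`ℝⁿ¹ × ℝⁿ² → ℝⁿ³` (`F₃ = F₁ * F₂`). [folklore] -/
def mulVec {F₁ F₂ : Submodule ℝ C(G, ℝ)} (h₁ : IsFlowDomain δ F₁) (h₂ : IsFlowDomain δ F₂)
    (h₃ : IsFlowDomain δ (F₁ * F₂)) : Vec F₁ →L[ℝ] Vec F₂ →L[ℝ] Vec (F₁ * F₂) :=
  LinearMap.toContinuousLinearMap
    ((LinearMap.toContinuousLinearMap : (Vec F₂ →ₗ[ℝ] Vec (F₁ * F₂)) ≃ₗ[ℝ] _).toLinearMap ∘ₗ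
      (LinearMap.mk₂ ℝ
        (fun (c₁ : Vec F₁) (c₂ : Vec F₂) => coord δ h₃
          ⟨((coord δ h₁).symm c₁ : C(G, ℝ)) * ((coord δ h₂).symm c₂ : C(G, ℝ)),
            Submodule.mul_mem_mul ((coord δ h₁).symm c₁).2 ((coord δ h₂).symm c₂).2⟩)
        (fun a₁ a₂ b => by
          rw [← map_add]; congr 1; apply Subtype.ext
          simp [add_mul])
        (fun c a b => by
          rw [← map_smul]; congr 1; apply Subtype.ext
          simp)
        (fun a b₁ b₂ => by
          rw [← map_add]; congr 1; apply Subtype.ext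
          simp [mul_add])
        (fun c a b => by
          rw [← map_smul]; congr 1; apply Subtype.ext
          simp)))

omit [CompactSpace G] in
/-- `mulVec` underneath: `coord⁻¹ (mulVec c₁ c₂) = coord⁻¹ c₁ * coord⁻¹ c₂`. [folklore] -/
theorem coe_symm_mulVec {F₁ F₂ : Submodule ℝ C(G, ℝ)} (h₁ : IsFlowDomain δ F₁) (h₂ : IsFlowDomain δ F₂)
    (h₃ : IsFlowDomain δ (F₁ * F₂)) (c₁ : Vec F₁) (c₂ : Vec F₂) :
    (((coord δ h₃).symm (mulVec δ h₁ h₂ h₃ c₁ c₂) : (F₁ * F₂ : Submodule ℝ C(G, ℝ))) : C(G, ℝ)) =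
      ((coord δ h₁).symm c₁ : C(G, ℝ)) * ((coord δ h₂).symm c₂ : C(G, ℝ)) := by
  simp [mulVec]

omit [CompactSpace G] in
/-- **The flow of a point derivation is multiplicative**: `α_t (u v) = α_t u · α_t v` on `R`.
Proof: in coordinates of the flow domain `F₃ = biSpan u * biSpan v`, both `s ↦ α_s(uv)` and
`s ↦ α_s u · α_s v` solve `y' = D₃ y` with `y(0) = uv` (Leibniz rule), and solutions are unique
(`eq_exp_smul_apply_of_hasDerivAt`). [folklore] -/
theorem IsPointDerivation.flow_mul {δ : C(G, ℝ) →ₗ[ℝ] ℝ} (hδ : IsPointDerivation δ)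
    {u v : C(G, ℝ)} (hu : u ∈ translationFinite G) (hv : v ∈ translationFinite G) (t : ℝ) :
    flow δ t (u * v) = flow δ t u * flow δ t v := by
  have h1 := isFlowDomain_biSpan δ hu
  have h2 := isFlowDomain_biSpan δ hv
  have h3 := h1.mul hδ h2
  set m := mulVec δ h1 h2 h3 with hm
  set c₁ := coord δ h1 ⟨u, self_mem_biSpan u⟩ with hc₁
  set c₂ := coord δ h2 ⟨v, self_mem_biSpan v⟩ with hc₂
  -- underlying functions of the coordinate curves
  have hXs : ∀ s, (((coord δ h1).symm (NormedSpace.exp (s • derivVec δ h1) c₁) : biSpan u) : C(G, ℝ)) =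
      flow δ s u := fun s => by
    rw [flow_eq_coe_flowOn δ h1 (self_mem_biSpan u), flowOn_apply]
  have hYs : ∀ s, (((coord δ h2).symm (NormedSpace.exp (s • derivVec δ h2) c₂) : biSpan v) : C(G, ℝ)) =
      flow δ s v := fun s => by
    rw [flow_eq_coe_flowOn δ h2 (self_mem_biSpan v), flowOn_apply]
  have hys : ∀ s, (((coord δ h3).symm (m (NormedSpace.exp (s • derivVec δ h1) c₁)
      (NormedSpace.exp (s • derivVec δ h2) c₂)) : (biSpan u * biSpan v : Submodule ℝ C(G, ℝ))) : C(G, ℝ)) =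
      flow δ s u * flow δ s v := fun s => by
    rw [hm, coe_symm_mulVec, hXs, hYs]
  -- the product curve solves `y' = D₃ y`
  have hy' : ∀ s, HasDerivAt
      (fun s : ℝ => m (NormedSpace.exp (s • derivVec δ h1) c₁) (NormedSpace.exp (s • derivVec δ h2) c₂))
      (derivVec δ h3 (m (NormedSpace.exp (s • derivVec δ h1) c₁) (NormedSpace.exp (s • derivVec δ h2) c₂))) s := by
    intro s
    have hXd := hasDerivAt_exp_smul_apply (derivVec δ h1) c₁ s
    have hYd := hasDerivAt_exp_smul_apply (derivVec δ h2) c₂ s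
    have h := ((m.hasFDerivAt).comp_hasDerivAt s hXd).clm_apply hYd
    simp only [Function.comp_def] at h
    have heq : m (derivVec δ h1 (NormedSpace.exp (s • derivVec δ h1) c₁)) (NormedSpace.exp (s • derivVec δ h2) c₂) +
        m (NormedSpace.exp (s • derivVec δ h1) c₁) (derivVec δ h2 (NormedSpace.exp (s • derivVec δ h2) c₂)) =
        derivVec δ h3 (m (NormedSpace.exp (s • derivVec δ h1) c₁) (NormedSpace.exp (s • derivVec δ h2) c₂)) := by
      apply (coord δ h3).symm.injective
      apply Subtype.ext
      rw [map_add, Submodule.coe_add, hm, coe_symm_mulVec, coe_symm_mulVec, derivVec_apply,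
        derivVec_apply, derivVec_apply, LinearEquiv.symm_apply_apply, LinearEquiv.symm_apply_apply,
        LinearEquiv.symm_apply_apply, coe_derivLin, coe_derivLin, coe_derivLin, hXs, hYs, ← hm, hys,
        hδ.leftDeriv_mul (flow_mem δ hu s) (flow_mem δ hv s)]
    rw [heq] at h
    exact h
  have hsol := eq_exp_smul_apply_of_hasDerivAt (derivVec δ h3) hy' rfl t
  -- `y 0 = coord (u v)`
  have huv : u * v ∈ biSpan u * biSpan v := Submodule.mul_mem_mul (self_mem_biSpan u) (self_mem_biSpan v)
  have hy0 : m (NormedSpace.exp ((0 : ℝ) • derivVec δ h1) c₁) (NormedSpace.exp ((0 : ℝ) • derivVec δ h2) c₂) =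
      coord δ h3 ⟨u * v, huv⟩ := by
    apply (coord δ h3).symm.injective
    apply Subtype.ext
    rw [hys, LinearEquiv.symm_apply_apply, flow_zero δ hu, flow_zero δ hv]
  rw [← hys t, hsol, hy0, flow_eq_coe_flowOn δ h3 huv, flowOn_apply]

omit [CompactSpace G] in
/-- `α_t (uⁿ) = (α_t u)ⁿ`. [folklore] -/
theorem IsPointDerivation.flow_pow {δ : C(G, ℝ) →ₗ[ℝ] ℝ} (hδ : IsPointDerivation δ)
    {u : C(G, ℝ)} (hu : u ∈ translationFinite G) (t : ℝ) (n : ℕ) :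
    flow δ t (u ^ n) = flow δ t u ^ n := by
  induction n with
  | zero => simp [hδ.flow_one]
  | succ n ih => rw [pow_succ, hδ.flow_mul (pow_mem hu n) hu, ih, pow_succ]

omit [CompactSpace G] in
/-- `α_{-t} (α_t u) = u`. [folklore] -/
theorem flow_neg_flow {u : C(G, ℝ)} (hu : u ∈ translationFinite G) (t : ℝ) :
    flow δ (-t) (flow δ t u) = u := by
  rw [← flow_add_time δ hu, neg_add_cancel, flow_zero δ hu]

omit [CompactSpace G] in
/-- `α_t (α_{-t} u) = u`. [folklore] -/
theorem flow_flow_neg {u : C(G, ℝ)} (hu : u ∈ translationFinite G) (t : ℝ) :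
    flow δ t (flow δ (-t) u) = u := by
  rw [← flow_add_time δ hu, add_neg_cancel, flow_zero δ hu]

end Compact

end Literature.RepresentationTheory.CompactGroups
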